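import Summits.QuantumAdvantage.QuantumAdvantage.Theorems.CharDialPartyDialF1

/-!
# PartyDial (decomp-qadv lens-5 g35), part F2 — §5 (window strategies): radius-r windows are separated (isSepLocal_{two,four}_of_window), windowLaw_two / windowLaw_four (hB : Best4Le), pieces SepFrobOdd / WindowFrobOdd PROVED, FrobHardOdd iff EntangledFrobOdd

See part A (`CharDialPartyDialA`) for the node header; memo `NODE-g35.md` (g35 folder of decomp-qadv-lens-5).
-/

set_option autoImplicit false
set_option linter.dupNamespace false

namespace Summit.QuantumAdvantage.QuantumAdvantage.Theorems.PartyDial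

open Finset
open Summit.QuantumAdvantage.AdviceFreeQNC0

/-! ### Window strategies -/

section Window

variable {n : ℕ}

/-- a RADIUS-`r` WINDOW strategy: cut `g` (between bits `g − 1` and `g`) reads only the bits `i` with
`g − r ≤ i ≤ g + r − 1`. -/
def WindowLocal (r : ℕ) (y : Fin (n + 1) → (Fin n → Bool) → Bool) : Prop :=
  ∀ (g : Fin (n + 1)) (u v : Fin n → Bool),
    (∀ i : Fin n, g.val ≤ i.val + r → i.val < g.val + r → u i = v i) → y g u = y g v

/-- an interval of `m₀` coordinates inside a set gives it at least `m₀` elements. -/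
theorem le_card_of_interval {m₀ lo : ℕ} (hlo : lo + m₀ ≤ n) (P : Fin n → Prop) [DecidablePred P]
    (hP : ∀ i : Fin n, lo ≤ i.val → i.val < lo + m₀ → P i) :
    m₀ ≤ (univ.filter fun i : Fin n => P i).card := by
  have hinj : Function.Injective fun t : Fin m₀ => (⟨lo + t.val, by omega⟩ : Fin n) := by
    intro t t' h
    have := congrArg Fin.val h
    exact Fin.ext (by simpa using this)
  calc m₀ = ((univ : Finset (Fin m₀)).map ⟨_, hinj⟩).card := by rw [card_map, card_univ, Fintype.card_fin]
    _ ≤ _ := Finset.card_le_card fun i hi => by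
        obtain ⟨t, -, rfl⟩ := Finset.mem_map.1 hi
        rw [mem_filter]
        exact ⟨mem_univ _, hP _ (by simp) (by simp)⟩

/-- **Window strategies are 2-separated** once `n ≥ 2m₀ + (2r − 1)`: one buffer of `2r − 1` free
coordinates after the first `m₀`. -/
theorem isSepLocal_two_of_window {r m₀ : ℕ} (hr : 1 ≤ r) (hn : 2 * m₀ + (2 * r - 1) ≤ n)
    {y : Fin (n + 1) → (Fin n → Bool) → Bool} (hy : WindowLocal r y) : IsSepLocal 2 m₀ y := by
  refine ⟨univ.filter fun i : Fin n => m₀ ≤ i.val ∧ i.val + 1 < m₀ + 2 * r,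
    fun i => if i.val < m₀ then 0 else 1, fun g => if g.val < m₀ + r then 0 else 1,
    fun i _ => by dsimp only; split_ifs <;> omega, fun g => by dsimp only; split_ifs <;> omega,
    fun i g hi h => ?_, fun i g hi h => ?_, fun g u v huv => hy g u v fun i h1 h2 => huv i ?_, fun j hj => ?_⟩
  · simp only [mem_filter, mem_univ, true_and, not_and, not_lt] at hi
    dsimp only at h
    split_ifs at h <;> omega
  · simp only [mem_filter, mem_univ, true_and, not_and, not_lt] at hi
    dsimp only at h
    split_ifs at h <;> omega
  · simp only [mem_filter, mem_univ, true_and]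
    by_cases hB : m₀ ≤ i.val ∧ i.val + 1 < m₀ + 2 * r
    · exact Or.inl hB
    · right; split_ifs <;> omega
  · interval_cases j
    · refine le_card_of_interval (lo := 0) (by omega) _ fun i h1 h2 => ?_
      simp only [mem_filter, mem_univ, true_and, not_and, not_lt]
      exact ⟨fun _ => by omega, by rw [if_pos (by omega)]⟩
    · refine le_card_of_interval (lo := m₀ + (2 * r - 1)) (by omega) _ fun i h1 h2 => ?_
      simp only [mem_filter, mem_univ, true_and, not_and, not_lt]
      exact ⟨fun _ => by omega, by rw [if_neg (by omega)]⟩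

/-- **Window strategies are 4-separated** once `n ≥ 4m₀ + 3(2r − 1)`: three buffers of `2r − 1` free
coordinates, period `L = m₀ + 2r − 1`. -/
theorem isSepLocal_four_of_window {r m₀ : ℕ} (hr : 1 ≤ r) (hn : 4 * m₀ + 3 * (2 * r - 1) ≤ n)
    {y : Fin (n + 1) → (Fin n → Bool) → Bool} (hy : WindowLocal r y) : IsSepLocal 4 m₀ y := by
  refine ⟨univ.filter fun i : Fin n =>
      (m₀ ≤ i.val ∧ i.val + 1 < m₀ + 2 * r) ∨
      (2 * m₀ + 2 * r - 1 ≤ i.val ∧ i.val + 2 < 2 * m₀ + 4 * r) ∨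
      (3 * m₀ + 4 * r - 2 ≤ i.val ∧ i.val + 3 < 3 * m₀ + 6 * r),
    fun i => if i.val + 1 < m₀ + 2 * r then 0 else if i.val + 2 < 2 * m₀ + 4 * r then 1
      else if i.val + 3 < 3 * m₀ + 6 * r then 2 else 3,
    fun g => if g.val < m₀ + r then 0 else if g.val + 1 < 2 * m₀ + 3 * r then 1
      else if g.val + 2 < 3 * m₀ + 5 * r then 2 else 3,
    fun i _ => by dsimp only; split_ifs <;> omega, fun g => by dsimp only; split_ifs <;> omega,
    fun i g hi h => ?_, fun i g hi h => ?_, fun g u v huv => hy g u v fun i h1 h2 => huv i ?_, fun j hj => ?_⟩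
  · simp only [mem_filter, mem_univ, true_and, not_or, not_and, not_lt] at hi
    dsimp only at h
    split_ifs at h <;> omega
  · simp only [mem_filter, mem_univ, true_and, not_or, not_and, not_lt] at hi
    dsimp only at h
    split_ifs at h <;> omega
  · simp only [mem_filter, mem_univ, true_and]
    by_cases hB : (m₀ ≤ i.val ∧ i.val + 1 < m₀ + 2 * r) ∨
      (2 * m₀ + 2 * r - 1 ≤ i.val ∧ i.val + 2 < 2 * m₀ + 4 * r) ∨
      (3 * m₀ + 4 * r - 2 ≤ i.val ∧ i.val + 3 < 3 * m₀ + 6 * r)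
    · exact Or.inl hB
    · right
      simp only [not_or, not_and, not_lt] at hB
      split_ifs <;> omega
  · interval_cases j
    · refine le_card_of_interval (lo := 0) (by omega) _ fun i h1 h2 => ?_
      simp only [mem_filter, mem_univ, true_and, not_or, not_and, not_lt]
      exact ⟨⟨fun _ => by omega, fun _ => by omega, fun _ => by omega⟩, by rw [if_pos (by omega)]⟩
    · refine le_card_of_interval (lo := m₀ + 2 * r - 1) (by omega) _ fun i h1 h2 => ?_
      simp only [mem_filter, mem_univ, true_and, not_or, not_and, not_lt]
      exact ⟨⟨fun _ => by omega, fun _ => by omega, fun _ => by omega⟩,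
        by rw [if_neg (by omega), if_pos (by omega)]⟩
    · refine le_card_of_interval (lo := 2 * m₀ + 4 * r - 2) (by omega) _ fun i h1 h2 => ?_
      simp only [mem_filter, mem_univ, true_and, not_or, not_and, not_lt]
      exact ⟨⟨fun _ => by omega, fun _ => by omega, fun _ => by omega⟩,
        by rw [if_neg (by omega), if_neg (by omega), if_pos (by omega)]⟩
    · refine le_card_of_interval (lo := 3 * m₀ + 6 * r - 3) (by omega) _ fun i h1 h2 => ?_
      simp only [mem_filter, mem_univ, true_and, not_or, not_and, not_lt]
      exact ⟨⟨fun _ => by omega, fun _ => by omega, fun _ => by omega⟩,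
        by rw [if_neg (by omega), if_neg (by omega), if_neg (by omega)]⟩

/-- **WINDOW LAW (`8/9`)**: a radius-`r` window strategy on `n ≥ 2m₀ + 2r − 1` bits wins on at most
`(1 − γ(m₀)²)·2ⁿ` inputs. -/
theorem windowLaw_two {r m₀ : ℕ} (hr : 1 ≤ r) (hm₀ : 1 ≤ m₀) (hn : 2 * m₀ + (2 * r - 1) ≤ n) (c : ℕ)
    (y : Fin (n + 1) → (Fin n → Bool) → Bool) (hy : WindowLocal r y) :
    ((univ.filter fun u : Fin n → Bool => ringWinU c y u = true).card : ℝ) ≤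
      (1 - gam m₀ ^ 2) * (2 : ℝ) ^ n :=
  sepLaw_two hm₀ c y (isSepLocal_two_of_window hr hn hy)

/-- **SEPARATED FOUR-SEGMENT LAW** (`2/3`, GIVEN the kernel check `Best4Le` of §0 — proved in §4, whence the
unconditional node-only form `sepLaw_four'` of §5d): every 4-separated strategy (segments `≥ m₀ ≥ 1`, any free
zone) wins on at most `(1 − 27·γ(m₀)⁴)·2ⁿ` inputs. -/
theorem sepLaw_four (hB : Best4Le) {m₀ : ℕ} (hm₀ : 1 ≤ m₀) (c : ℕ)
    (y : Fin (n + 1) → (Fin n → Bool) → Bool) (hy : IsSepLocal 4 m₀ y) :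
    ((univ.filter fun u : Fin n → Bool => ringWinU c y u = true).card : ℝ) ≤
      (1 - 27 * gam m₀ ^ 4) * (2 : ℝ) ^ n := by
  have h := sep_law 4 54 (nWins_four_le_of hB) hm₀ c y hy
  norm_num at h
  exact h

/-- **WINDOW LAW (`2/3`)**: a radius-`r` window strategy on `n ≥ 4m₀ + 3(2r − 1)` bits wins on at most
`(1 − 27·γ(m₀)⁴)·2ⁿ` inputs; e.g. `r ≤ n/8` forces the value down to `2/3 + O(2^{-n/16})`-ish, the
blind value `2/3` being attained by one blind cut. -/
theorem windowLaw_four (hB : Best4Le) {r m₀ : ℕ} (hr : 1 ≤ r) (hm₀ : 1 ≤ m₀)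
    (hn : 4 * m₀ + 3 * (2 * r - 1) ≤ n)
    (c : ℕ) (y : Fin (n + 1) → (Fin n → Bool) → Bool) (hy : WindowLocal r y) :
    ((univ.filter fun u : Fin n → Bool => ringWinU c y u = true).card : ℝ) ≤
      (1 - 27 * gam m₀ ^ 4) * (2 : ℝ) ^ n :=
  sepLaw_four hB hm₀ c y (isSepLocal_four_of_window hr hn hy)

/-! ### The pieces of `CharDial.FrobHardOdd` after §5: the separated sector is decided -/

/-- piece (A′), the SEPARATED sector: `FrobHardOdd` restricted to degree-`(p−1)` strategies that are
2-separated with segments `≥ 2` (some free zone splits the reads).  [PROVED for every `n` with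
`θ = 1 − γ(2)² = 35/36`, the degree hypothesis unused: `sepFrobOdd_holds`; strictly WEAKER than T;
contains the two-block sector (A) and every radius-`r` window strategy with `2r + 3 ≤ n`] -/
def SepFrobOdd : Prop :=
  ∀ (p : ℕ) [Fact p.Prime], 5 ≤ p → ∃ θ : ℝ, θ < 1 ∧ ∃ n₀ : ℕ, ∀ n ≥ n₀, ∀ c : ℕ,
    ∀ y : Fin (n + 1) → (Fin n → Bool) → Bool, (∀ g, HasDegF p (y g) (p - 1)) → IsSepLocal 2 2 y →
      ((univ.filter fun u : Fin n → Bool => ringWinU c y u = true).card : ℝ) ≤ θ * (2 : ℝ) ^ n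

/-- piece (B′), the ENTANGLED residual: `FrobHardOdd` restricted to degree-`(p−1)` strategies that are
NOT 2-separated (segments `≥ 2`): for every free zone and every two separated pairs of active coordinates,
some cut on the wrong side reads across.  [T-implied: `entangledFrobOdd_of_frobHardOdd`; UNDECIDED;
`⟺ FrobHardOdd`: `frobHardOdd_iff_entangled`; implies the g35-rev1 residual `CrossingFrobOdd`
restricted further: `entangled ⊆ crossing` as classes (`crossingFrobOdd_of_entangled`)] -/
def EntangledFrobOdd : Prop :=
  ∀ (p : ℕ) [Fact p.Prime], 5 ≤ p → ∃ θ : ℝ, θ < 1 ∧ ∃ n₀ : ℕ, ∀ n ≥ n₀, ∀ c : ℕ,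
    ∀ y : Fin (n + 1) → (Fin n → Bool) → Bool, (∀ g, HasDegF p (y g) (p - 1)) → ¬ IsSepLocal 2 2 y →
      ((univ.filter fun u : Fin n → Bool => ringWinU c y u = true).card : ℝ) ≤ θ * (2 : ℝ) ^ n

/-- piece (W), the WINDOW sector: `FrobHardOdd` restricted to radius-`r` window strategies, any `r` with
`2r + 3 ≤ n` (each cut blind to at least the two extreme bits on one side).  [PROVED for every `n` with
`θ = 35/36`: `windowFrobOdd_holds`; strictly WEAKER than T] -/
def WindowFrobOdd : Prop :=
  ∀ (p : ℕ) [Fact p.Prime], 5 ≤ p → ∃ θ : ℝ, θ < 1 ∧ ∃ n₀ : ℕ, ∀ n ≥ n₀, ∀ c r : ℕ, 2 * r + 3 ≤ n →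
    ∀ y : Fin (n + 1) → (Fin n → Bool) → Bool, (∀ g, HasDegF p (y g) (p - 1)) → WindowLocal r y →
      ((univ.filter fun u : Fin n → Bool => ringWinU c y u = true).card : ℝ) ≤ θ * (2 : ℝ) ^ n

/-- `γ(2)² > 0` (numeric: `γ(2) = 1/6`). -/
theorem gam_two_sq_pos : 0 < gam 2 ^ 2 := by unfold gam; norm_num

/-- piece (A′) holds outright. -/
theorem sepFrobOdd_holds : SepFrobOdd := by
  intro p _ _
  refine ⟨1 - gam 2 ^ 2, by linarith [gam_two_sq_pos], 0, fun n _ c y _ hy => ?_⟩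
  exact sepLaw_two (by norm_num) c y hy

/-- piece (W) holds outright (`n₀ = 5`; radius-`0` windows are constant cuts, hence radius-`1` windows). -/
theorem windowFrobOdd_holds : WindowFrobOdd := by
  intro p _ _
  refine ⟨1 - gam 2 ^ 2, by linarith [gam_two_sq_pos], 5, fun n hn c r hrn y _ hy => ?_⟩
  rcases Nat.eq_zero_or_pos r with hr | hr
  · -- radius 0: every cut is constant, hence a radius-1 window strategy (`n ≥ 5`)
    subst hr
    have hy1 : WindowLocal 1 y := fun g u v _ => hy g u v fun i h1 h2 => by omega
    exact sepLaw_two (by norm_num) c y (isSepLocal_two_of_window le_rfl (by omega) hy1)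
  · exact sepLaw_two (by norm_num) c y (isSepLocal_two_of_window hr (by omega) hy)

/-- T ⟹ (B′) (projection). -/
theorem entangledFrobOdd_of_frobHardOdd
    (hT : Summit.QuantumAdvantage.QuantumAdvantage.Theses.CharDial.FrobHardOdd) : EntangledFrobOdd := by
  intro p _ hp
  obtain ⟨θ, hθ, n₀, h⟩ := hT p hp
  exact ⟨θ, hθ, n₀, fun n hn c y hy _ => h n hn c y hy⟩

/-- ★★★ item 32598 from its ENTANGLED residual alone. -/
theorem frobHardOdd_of_entangled (hB : EntangledFrobOdd) :
    Summit.QuantumAdvantage.QuantumAdvantage.Theses.CharDial.FrobHardOdd := by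
  intro p _ hp
  obtain ⟨θ₂, hθ₂, n₂, h₂⟩ := hB p hp
  refine ⟨max (1 - gam 2 ^ 2) θ₂, max_lt (by linarith [gam_two_sq_pos]) hθ₂, n₂, fun n hn c y hy => ?_⟩
  have h2 : (0 : ℝ) ≤ (2 : ℝ) ^ n := by positivity
  by_cases hS : IsSepLocal 2 2 y
  · exact (sepLaw_two (by norm_num) c y hS).trans (mul_le_mul_of_nonneg_right (le_max_left _ _) h2)
  · exact (h₂ n hn c y hy hS).trans (mul_le_mul_of_nonneg_right (le_max_right _ _) h2)

/-- **The dial on T after §5**: `FrobHardOdd ⟺ EntangledFrobOdd` (the separated sector is decided). -/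
theorem frobHardOdd_iff_entangled :
    Summit.QuantumAdvantage.QuantumAdvantage.Theses.CharDial.FrobHardOdd ↔ EntangledFrobOdd :=
  ⟨entangledFrobOdd_of_frobHardOdd, frobHardOdd_of_entangled⟩

/-- 2-block-local with blocks `≥ 6` ⟹ 2-separated with segments `≥ 2` (the residual class SHRINKS). -/
theorem isSepLocal_two_two_of_isBlockLocal {y : Fin (n + 1) → (Fin n → Bool) → Bool}
    (hy : IsBlockLocal 2 6 y) : IsSepLocal 2 2 y := by
  obtain ⟨B, sg, pty, h1, h2, h3, h4, h5, h6⟩ := isSepLocal_of_isBlockLocal hy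
  exact ⟨B, sg, pty, h1, h2, h3, h4, h5, fun j hj => (by norm_num : (2 : ℕ) ≤ 6).trans (h6 j hj)⟩

/-- every `k`-separated strategy with segments `≥ 2` (`k ≥ 2`) lies in the decided sector: the entangled
residual excludes them all. -/
theorem isSepLocal_two_two_of_sep {k m₀ : ℕ} {y : Fin (n + 1) → (Fin n → Bool) → Bool}
    (hy : IsSepLocal k m₀ y) (hk : 2 ≤ k) (hm : 2 ≤ m₀) : IsSepLocal 2 2 y :=
  (hy.two hk).mono hm

/-- (B′) ⟹ (B): the entangled residual implies the crossing residual of §3 directly (its class is smaller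
and the separated complement is decided). -/
theorem crossingFrobOdd_of_entangled (hB : EntangledFrobOdd) : CrossingFrobOdd :=
  crossingFrobOdd_of_frobHardOdd (frobHardOdd_of_entangled hB)

end Window

end Summit.QuantumAdvantage.QuantumAdvantage.Theorems.PartyDial
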